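import Mathlib
import Summits.CriticalPhenomena.PercolationContinuityZ3.Theorems.PercNearOneGluingNoHeavyLowerTailSteinerBlobMeasure
import Summits.CriticalPhenomena.PercolationContinuityZ3.Theorems.PercNearOneGluingNoHeavyLowerTailPendantStarCore
import Literature.Probability.Percolation.HierarchicalPercolation
import HarnessLib

/-!
# `NoHeavyLowerTail` (stmt-CriticalPhenomena-4575) — INTERNAL-EDGE gluing: additive gluing with the relays'
# unreliability measured after deleting only the pairs INSIDE the observer's relay-free region

Support file (depth prover `nh-dp-blobmono`, respawn g5; `--supports stmt-CriticalPhenomena-4575`).  No definitions,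
no named facts, no sorries.

`μ = prodBernoulli w` on the pairs of `Fin n`, relays `A ∋ b`, a region `R ∋ o` disjoint from `A` and CLOSED (every
positive-weight pair from `R` to a non-relay stays in `R`; e.g. `R` = `o` with all non-relay vertices reachable from
`o` through positive pairs avoiding `A`).  Write `G − E(R)` for the weights with every pair INSIDE `R` set to `0`
(pairs from `R` to relays — the ports — are KEPT; `killE R w = fun e => if (∀ x ∈ e, x ∈ R) then 0 else w e`).

* `internalEdgeGluing` — **`μ(o ↔ A) − μ(o ↔ b) ≤ max_{a ∈ A} μ_{G−E(R)}(a ↮ b)`** (stated with a slack `θ`).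
  So Kozma–Nitzan's Conjecture 3 holds with the LINEAR rate `δ ↦ 2δ`-type on the class of observers whose relays
  stay `(1−t)`-reliable when the pairs inside the observer's relay-free region are deleted — the relays may still
  use every vertex of the region as a one-step stepping stone between two relays, they only may not use a pair
  of region vertices.  This single statement contains: Kozma–Nitzan's Thm 4 in additive form (`R = {o}`,
  `E(R) = ∅`: `blockStarGluing`), `pocketDeletionGluing` (there ALL pairs meeting `R` are deleted),
  `nearOneGluing_of_relayCore` (there only the pairs inside `A` are kept) and `nearOneGluing_of_inessential`
  (there all pairs meeting every `U ∋ o`, `U ⊆ R`, are deleted); none of them covers e.g. `o` adjacent to two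
  adjacent relay-hubs `h₁ ~ h₂` (all relay connectivity through the hubs), where the present bound is linear.
* Proof: decompose along the RELAY-FREE CLUSTER `V₀` of `o` (the Steiner-blob decomposition of lemma factory #6,
  `…SteinerBlobContraction/Measure`: blob events `Blob(V₀)` partition, are independent of the contraction `Ψ`,
  `Ψ_* μ_w = μ_{w̃}`, and on `Blob(V₀)` reachability from `o`/relays is read through `Ψ`); under the blob weights `w̃`
  the observer is ONE-LAYER, so `pocketGlue_base` (= `blockStarGluing`, KN Thm 4 block form) bounds the per-blob
  defect by `max_a μ_{w̃}(a ↮ b)`; and `μ_{w̃}(a ↮ b) ≤ μ_{G−E(R)}(a ↮ b)` because an open `a–b` path using no pair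
  inside `R` survives the contraction (`reachable_contract_of_reachable_inter`, a graph homomorphism; the law of
  `ω ∩ D` is `prodBernoulli` with the weights off `D` switched off, `prodBernoulli_map_inter`).
* Companion file `…InternalEdgeGluingBridge.lean`: the set bridge `μ(R ↮ b)·μ_{G−E(R)}(a ↮ b) ≤ μ(a ↮ b)` and the
  Conjecture-3 forms `μ(R ↮ b) ≤ μ(o ↮ A) + √t`, `μ(o ↮ b) ≤ μ(o ↮ A) + √t + Σ_{z ∈ R∖{o}} μ(o ↮ z)`.
-/

namespace Summit.CriticalPhenomena.PercolationContinuityZ3.Theorems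

open MeasureTheory Set
open Literature.Probability.LatticeModels (prodBernoulli prodBernoulli_real_mono_of_isUpperSet
  prodBernoulli_harris_lower)
open Literature.Probability.Percolation (BondConfig openConn openConnIn openGraph openGraph_adj
  isUpperSet_openConn isUpperSet_openConnIn)

noncomputable section
open Classical

variable {n : ℕ}

namespace InternalEdge

/-! ### 1. An open path avoiding the pairs inside `R` survives the blob contraction -/

/-- The admissible pairs: pairs avoiding `R`, and ports `s(u,a)`, `u ∈ R`, `a ∈ A`. -/
theorem adm_endpoints {R A : Finset (Fin n)} {x y : Fin n}
    (he : (∀ v ∈ s(x, y), v ∉ R) ∨ ∃ a ∈ A, ∃ u ∈ R, s(x, y) = s(u, a)) :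
    (x ∉ R ∧ y ∉ R) ∨ (x ∈ R ∧ y ∈ A) ∨ (x ∈ A ∧ y ∈ R) := by
  rcases he with h | ⟨a, ha, u, hu, hxy⟩
  · exact Or.inl ⟨h x (Sym2.mem_mk_left x y), h y (Sym2.mem_mk_right x y)⟩
  · rcases Sym2.eq_iff.1 hxy with ⟨rfl, rfl⟩ | ⟨rfl, rfl⟩
    · exact Or.inr (Or.inl ⟨hu, ha⟩)
    · exact Or.inr (Or.inr ⟨ha, hu⟩)

/-- **Path survival.**  For `V₀ ⊆ R`, `R` disjoint from `A`, `o ∈ V₀`: if `x ↔ y` in the configuration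
`ω ∩ D`, `D` = pairs avoiding `R` or ports of `R`, then `φ x ↔ φ y` in the contraction `Ψ(ω)`, where `φ` sends
`V₀` to `o` and fixes the rest. [this work] -/
theorem reachable_contract_of_reachable_inter {o : Fin n} {A R V₀ : Finset (Fin n)} (ho : o ∈ V₀)
    (hVR : V₀ ⊆ R) (hRA : Disjoint R A) (ω : BondConfig (Fin n)) {x y : Fin n}
    (hxy : (openGraph (ω ∩ {e : Sym2 (Fin n) | (∀ v ∈ e, v ∉ R) ∨ ∃ a ∈ A, ∃ u ∈ R, e = s(u, a)})).Reachable x y) :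
    (openGraph ({e : Sym2 (Fin n) | (e ∈ ω ∧ ∀ v ∈ e, v ∉ V₀) ∨
        ∃ a ∈ A, e = s(o, a) ∧ ∃ u ∈ V₀, s(u, a) ∈ ω} : Set (Sym2 (Fin n)))).Reachable
      (if x ∈ V₀ then o else x) (if y ∈ V₀ then o else y) := by
  set D : Set (Sym2 (Fin n)) := {e | (∀ v ∈ e, v ∉ R) ∨ ∃ a ∈ A, ∃ u ∈ R, e = s(u, a)} with hD
  set η : BondConfig (Fin n) := {e : Sym2 (Fin n) | (e ∈ ω ∧ ∀ v ∈ e, v ∉ V₀) ∨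
        ∃ a ∈ A, e = s(o, a) ∧ ∃ u ∈ V₀, s(u, a) ∈ ω} with hη
  let φ : Fin n → Fin n := fun v => if v ∈ V₀ then o else v
  -- `φ` is a graph homomorphism from the open graph of `ω ∩ D` to the open graph of `η`
  have hadj : ∀ u v : Fin n, (openGraph (ω ∩ D)).Adj u v → (openGraph η).Adj (φ u) (φ v) := by
    intro u v huv
    rw [openGraph_adj] at huv
    obtain ⟨⟨huvω, huvD⟩, hne⟩ := huv
    have hcase := adm_endpoints (R := R) (A := A) huvD
    rw [openGraph_adj]
    rcases hcase with ⟨huR, hvR⟩ | ⟨huR, hvA⟩ | ⟨huA, hvR⟩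
    · -- both endpoints off `R`, hence off `V₀`: the pair is kept
      have huV : u ∉ V₀ := fun h => huR (hVR h)
      have hvV : v ∉ V₀ := fun h => hvR (hVR h)
      simp only [φ, if_neg huV, if_neg hvV]
      refine ⟨Or.inl ⟨huvω, ?_⟩, hne⟩
      intro z hz
      rcases Sym2.mem_iff.1 hz with rfl | rfl
      · exact huV
      · exact hvV
    · -- a port `s(u, a)` with `u ∈ R`, `v = a ∈ A`
      have hvV : v ∉ V₀ := fun h => Finset.disjoint_left.1 hRA (hVR h) hvA
      have hvo : v ≠ o := fun h => hvV (h ▸ ho)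
      by_cases huV : u ∈ V₀
      · simp only [φ, if_pos huV, if_neg hvV]
        exact ⟨Or.inr ⟨v, hvA, rfl, u, huV, huvω⟩, hvo.symm⟩
      · simp only [φ, if_neg huV, if_neg hvV]
        refine ⟨Or.inl ⟨huvω, ?_⟩, hne⟩
        intro z hz
        rcases Sym2.mem_iff.1 hz with rfl | rfl
        · exact huV
        · exact hvV
    · -- a port the other way round
      have huV : u ∉ V₀ := fun h => Finset.disjoint_left.1 hRA (hVR h) huA
      have huo : u ≠ o := fun h => huV (h ▸ ho)
      by_cases hvV : v ∈ V₀
      · simp only [φ, if_pos hvV, if_neg huV]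
        refine ⟨Or.inr ⟨u, huA, ?_, v, hvV, ?_⟩, huo⟩
        · exact Sym2.eq_swap
        · rw [Sym2.eq_swap]; exact huvω
      · simp only [φ, if_neg huV, if_neg hvV]
        refine ⟨Or.inl ⟨huvω, ?_⟩, hne⟩
        intro z hz
        rcases Sym2.mem_iff.1 hz with rfl | rfl
        · exact huV
        · exact hvV
  let Φ : (openGraph (ω ∩ D)) →g (openGraph η) := ⟨φ, fun {u v} h => hadj u v h⟩
  exact hxy.map Φ


/-! ### 2. The blob weights are at least as connective as `G − E(R)` for relay pairs -/

/-- **`μ_{w̃}(a ↮ b) ≤ μ_{G−E(R)}(a ↮ b)`** for the blob weights `w̃` of a blob `V₀ ⊆ R` (`o ∈ V₀`, `R` closed and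
disjoint from `A ∋ a, b`): an open `a–b` path of `ω` using no pair inside `R` is an open path of the contraction
`Ψ(ω)`, and `ω ∩ D` has law `prodBernoulli` with the pairs off `D` switched off. [this work] -/
theorem blobWeight_compl_le_killE (w : Sym2 (Fin n) → unitInterval) {o : Fin n} {A R V₀ : Finset (Fin n)}
    (ho : o ∈ V₀) (hVR : V₀ ⊆ R) (hRA : Disjoint R A)
    (hcl : ∀ x ∈ R, ∀ y : Fin n, y ∉ R → y ∉ A → w s(x, y) = 0)
    {a b : Fin n} (ha : a ∈ A) (hb : b ∈ A) :
    (prodBernoulli (fun e : Sym2 (Fin n) => (⟨(prodBernoulli w).real {ω : BondConfig (Fin n) |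
        e ∈ ({e : Sym2 (Fin n) | (e ∈ ω ∧ ∀ v ∈ e, v ∉ V₀) ∨
          ∃ a ∈ A, e = s(o, a) ∧ ∃ u ∈ V₀, s(u, a) ∈ ω} : Set (Sym2 (Fin n)))},
        ⟨measureReal_nonneg, measureReal_le_one⟩⟩ : unitInterval))).real (openConn a b)ᶜ ≤
      (prodBernoulli (fun e : Sym2 (Fin n) => if (∀ x ∈ e, x ∈ R) then 0 else w e)).real (openConn a b)ᶜ := by
  have hVA : Disjoint V₀ A := Finset.disjoint_of_subset_left hVR hRA
  set D : Set (Sym2 (Fin n)) := {e | (∀ v ∈ e, v ∉ R) ∨ ∃ a ∈ A, ∃ u ∈ R, e = s(u, a)} with hD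
  set Ψ : BondConfig (Fin n) → BondConfig (Fin n) := fun ω =>
    ({e : Sym2 (Fin n) | (e ∈ ω ∧ ∀ v ∈ e, v ∉ V₀) ∨
      ∃ a ∈ A, e = s(o, a) ∧ ∃ u ∈ V₀, s(u, a) ∈ ω} : BondConfig (Fin n)) with hΨ
  set kE : Sym2 (Fin n) → unitInterval := fun e => if (∀ x ∈ e, x ∈ R) then 0 else w e with hkE
  set kD : Sym2 (Fin n) → unitInterval := fun e => if e ∈ D then w e else 0 with hkD
  have haR : a ∉ R := fun h => Finset.disjoint_left.1 hRA h ha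
  have hbR : b ∉ R := fun h => Finset.disjoint_left.1 hRA h hb
  have haV : a ∉ V₀ := fun h => haR (hVR h)
  have hbV : b ∉ V₀ := fun h => hbR (hVR h)
  -- the two weight functions `kD` (pairs off `D` killed) and `kE` (pairs inside `R` killed) coincide
  have hk : kD = kE := by
    funext e
    induction e using Sym2.ind with
    | h x y =>
      simp only [hkD, hkE]
      by_cases hxR : x ∈ R
      · by_cases hyR : y ∈ R
        · have hin : ∀ z ∈ s(x, y), z ∈ R := by
            intro z hz; rcases Sym2.mem_iff.1 hz with rfl | rfl <;> assumption
          have hnD : s(x, y) ∉ D := by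
            rintro (h | ⟨a', ha', u, hu, hxy⟩)
            · exact h x (Sym2.mem_mk_left x y) hxR
            · rcases Sym2.eq_iff.1 hxy with ⟨rfl, rfl⟩ | ⟨rfl, rfl⟩
              · exact Finset.disjoint_left.1 hRA hyR ha'
              · exact Finset.disjoint_left.1 hRA hxR ha'
          rw [if_neg hnD, if_pos hin]
        · have hnin : ¬ ∀ z ∈ s(x, y), z ∈ R := fun h => hyR (h y (Sym2.mem_mk_right x y))
          rw [if_neg hnin]
          by_cases hyA : y ∈ A
          · have hmem : s(x, y) ∈ D := Or.inr ⟨y, hyA, x, hxR, rfl⟩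
            rw [if_pos hmem]
          · have hnD : s(x, y) ∉ D := by
              rintro (h | ⟨a', ha', u, hu, hxy⟩)
              · exact h x (Sym2.mem_mk_left x y) hxR
              · rcases Sym2.eq_iff.1 hxy with ⟨rfl, rfl⟩ | ⟨rfl, rfl⟩
                · exact hyA ha'
                · exact Finset.disjoint_left.1 hRA hxR ha'
            rw [if_neg hnD, hcl x hxR y hyR hyA]
      · by_cases hyR : y ∈ R
        · have hnin : ¬ ∀ z ∈ s(x, y), z ∈ R := fun h => hxR (h x (Sym2.mem_mk_left x y))
          rw [if_neg hnin]
          by_cases hxA : x ∈ A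
          · have hmem : s(x, y) ∈ D := Or.inr ⟨x, hxA, y, hyR, Sym2.eq_swap⟩
            rw [if_pos hmem]
          · have hnD : s(x, y) ∉ D := by
              rintro (h | ⟨a', ha', u, hu, hxy⟩)
              · exact h y (Sym2.mem_mk_right x y) hyR
              · rcases Sym2.eq_iff.1 hxy with ⟨rfl, rfl⟩ | ⟨rfl, rfl⟩
                · exact Finset.disjoint_left.1 hRA hyR ha'
                · exact hxA ha'
            rw [if_neg hnD, Sym2.eq_swap, hcl y hyR x hxR hxA]
        · have hnin : ¬ ∀ z ∈ s(x, y), z ∈ R := fun h => hxR (h x (Sym2.mem_mk_left x y))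
          have hmem : s(x, y) ∈ D := Or.inl fun z hz => by
            rcases Sym2.mem_iff.1 hz with rfl | rfl
            · exact hxR
            · exact hyR
          rw [if_neg hnin, if_pos hmem]
  -- law of `ω ∩ D`
  have hmap : (prodBernoulli w).map (fun ξ : BondConfig (Fin n) => ξ ∩ D) = prodBernoulli kD :=
    Literature.Probability.Percolation.prodBernoulli_map_inter w D
  have hmeasf : Measurable (fun ξ : BondConfig (Fin n) => ξ ∩ D) := Measurable.of_discrete
  have h1 : (prodBernoulli kE).real (openConn a b) =
      (prodBernoulli w).real ((fun ξ : BondConfig (Fin n) => ξ ∩ D) ⁻¹' (openConn a b)) := by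
    rw [← hk, ← hmap, measureReal_def, measureReal_def, Measure.map_apply hmeasf MeasurableSet.of_discrete]
  -- pushforward under the contraction
  have h2 : (prodBernoulli w).real (Ψ ⁻¹' (openConn a b : Set (BondConfig (Fin n)))) =
      (prodBernoulli (fun e : Sym2 (Fin n) => (⟨(prodBernoulli w).real {ω : BondConfig (Fin n) | e ∈ Ψ ω},
        ⟨measureReal_nonneg, measureReal_le_one⟩⟩ : unitInterval))).real (openConn a b) :=
    SteinerBlob.measureReal_preimage_contract w hVA (openConn a b)
  -- path survival: `(ω ∩ D) ∈ {a ↔ b}` implies `Ψ ω ∈ {a ↔ b}`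
  have hsub : ((fun ξ : BondConfig (Fin n) => ξ ∩ D) ⁻¹' (openConn a b : Set (BondConfig (Fin n)))) ⊆
      Ψ ⁻¹' (openConn a b : Set (BondConfig (Fin n))) := by
    intro ω hω
    have h := InternalEdge.reachable_contract_of_reachable_inter ho hVR hRA ω hω
    rw [if_neg haV, if_neg hbV] at h
    exact h
  have hmono := measureReal_mono hsub (measure_ne_top (prodBernoulli w) _)
  rw [probReal_compl_eq_one_sub (pocketGlue_measurableSet _),
    probReal_compl_eq_one_sub (pocketGlue_measurableSet _)]
  have : (prodBernoulli kE).real (openConn a b) ≤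
      (prodBernoulli (fun e : Sym2 (Fin n) => (⟨(prodBernoulli w).real {ω : BondConfig (Fin n) | e ∈ Ψ ω},
        ⟨measureReal_nonneg, measureReal_le_one⟩⟩ : unitInterval))).real (openConn a b) := by
    rw [h1, ← h2]; exact hmono
  linarith


/-! ### 3. Blobs leaving the closed region are null -/

/-- A blob value `V₀` not contained in the closed region `R ∋ o` has probability `0`: the relay-free cluster of
`o` would have to leave `R` through a weight-zero pair. [this work] -/
theorem blob_null (w : Sym2 (Fin n) → unitInterval) {o : Fin n} {A R V₀ : Finset (Fin n)} (hoR : o ∈ R)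
    (hVA : Disjoint V₀ A) (hcl : ∀ x ∈ R, ∀ y : Fin n, y ∉ R → y ∉ A → w s(x, y) = 0) (hV : ¬ V₀ ⊆ R) :
    (prodBernoulli w).real ({ω : BondConfig (Fin n) | (∀ u ∈ V₀, ω ∈ openConnIn (↑V₀ : Set (Fin n)) o u) ∧
        ∀ u ∈ V₀, ∀ x, x ∉ V₀ → x ∉ A → s(u, x) ∉ ω}) = 0 := by
  set μ := prodBernoulli w with hμ
  obtain ⟨u, huV, huR⟩ := Finset.not_subset.1 hV
  set Z : Set (Sym2 (Fin n)) := {e | w e = 0} with hZ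
  have hae : ∀ᵐ ω ∂μ, ∀ e ∈ Z, e ∉ ω :=
    Literature.Probability.LatticeModels.prodBernoulli_ae_forall_notMem w (Set.to_countable Z) fun e he => he
  -- on the a.e. event, the blob event is impossible
  have hsub : {ω : BondConfig (Fin n) | (∀ u ∈ V₀, ω ∈ openConnIn (↑V₀ : Set (Fin n)) o u) ∧
        ∀ u ∈ V₀, ∀ x, x ∉ V₀ → x ∉ A → s(u, x) ∉ ω} ⊆ {ω : BondConfig (Fin n) | ¬ ∀ e ∈ Z, e ∉ ω} := by
    intro ω hω hgood
    obtain ⟨hin, -⟩ := hω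
    have hou := hin u huV
    rw [Literature.Probability.Percolation.DCT16.mem_openConnIn_iff_pathIn] at hou
    obtain ⟨-, hpath⟩ := hou
    -- every vertex reached from `o` inside `V₀` stays in `R`
    have key : ∀ z, Relation.ReflTransGen (fun a b => (openGraph ω).Adj a b ∧ b ∈ (↑V₀ : Set (Fin n))) o z →
        z ∈ R := by
      intro z hz
      induction hz with
      | refl => exact hoR
      | tail _ hstep ih =>
        obtain ⟨hadj, hbV⟩ := hstep
        by_contra hbR
        have hbA : _ ∉ A := fun h => Finset.disjoint_left.1 hVA (Finset.mem_coe.1 hbV) h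
        rw [openGraph_adj] at hadj
        have hw0 := hcl _ ih _ hbR hbA
        exact hgood _ hw0 hadj.1
    exact huR (key u hpath)
  have hnull : μ {ω : BondConfig (Fin n) | ¬ ∀ e ∈ Z, e ∉ ω} = 0 := ae_iff.1 hae
  have hle := measureReal_mono hsub (measure_ne_top μ _)
  have h0 : μ.real {ω : BondConfig (Fin n) | ¬ ∀ e ∈ Z, e ∉ ω} = 0 := by
    rw [measureReal_def, hnull, ENNReal.toReal_zero]
  rw [h0] at hle
  exact le_antisymm hle measureReal_nonneg

end InternalEdge

/-! ### 4. The internal-edge gluing theorem -/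

/-- **Internal-edge gluing.**  Relays `A ∋ b`, a closed region `R ∋ o` disjoint from `A` (every positive-weight
pair from `R` to a non-relay stays in `R`).  If every relay has `μ_{G−E(R)}(a ↮ b) ≤ θ` — unreliability after
deleting the pairs INSIDE `R` only (ports kept) — then `μ(o ↔ A) − μ(o ↔ b) ≤ θ`.  Contains Kozma–Nitzan's
Theorem 4 (additive form, `R = {o}`), `pocketDeletionGluing`, `nearOneGluing_of_relayCore` and
`nearOneGluing_of_inessential` as special cases of the hypothesis. [this work; cite: KozmaNitzan2024, Thm. 4 (p. 12)] -/
theorem internalEdgeGluing (w : Sym2 (Fin n) → unitInterval) (R A : Finset (Fin n)) (o b : Fin n) (θ : ℝ)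
    (hbA : b ∈ A) (hoR : o ∈ R) (hRA : Disjoint R A)
    (hcl : ∀ x ∈ R, ∀ y : Fin n, y ∉ R → y ∉ A → w s(x, y) = 0)
    (hrel : ∀ a ∈ A, (prodBernoulli (fun e : Sym2 (Fin n) =>
      if (∀ x ∈ e, x ∈ R) then 0 else w e)).real (openConn a b)ᶜ ≤ θ) :
    (prodBernoulli w).real (⋃ a ∈ A, (openConn o a : Set (BondConfig (Fin n)))) -
      (prodBernoulli w).real (openConn o b) ≤ θ := by
  set μ := prodBernoulli w with hμ
  have hoA : o ∉ A := fun h => Finset.disjoint_left.1 hRA hoR h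
  have hθ0 : 0 ≤ θ := by
    have h := hrel b hbA
    have huniv : (openConn b b : Set (BondConfig (Fin n))) = Set.univ :=
      Set.eq_univ_of_forall fun _ => SimpleGraph.Reachable.refl _
    rw [huniv, Set.compl_univ, measureReal_empty] at h
    exact h
  set EA : Set (BondConfig (Fin n)) := ⋃ a ∈ A, (openConn o a : Set (BondConfig (Fin n))) with hEA
  set Eb : Set (BondConfig (Fin n)) := openConn o b with hEb
  set 𝒱 : Finset (Finset (Fin n)) :=
    (Finset.univ : Finset (Finset (Fin n))).filter (fun V₀ => o ∈ V₀ ∧ Disjoint V₀ A) with h𝒱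
  set Bl : Finset (Fin n) → Set (BondConfig (Fin n)) := fun V₀ =>
    {ω : BondConfig (Fin n) | (∀ u ∈ V₀, ω ∈ openConnIn (↑V₀ : Set (Fin n)) o u) ∧
      ∀ u ∈ V₀, ∀ x, x ∉ V₀ → x ∉ A → s(u, x) ∉ ω} with hBl
  have hsumA : ∑ V₀ ∈ 𝒱, μ.real (EA ∩ Bl V₀) = μ.real EA := SteinerBlob.sum_measureReal_inter_blob w A o hoA EA
  have hsumb : ∑ V₀ ∈ 𝒱, μ.real (Eb ∩ Bl V₀) = μ.real Eb := SteinerBlob.sum_measureReal_inter_blob w A o hoA Eb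
  have hsum1 : ∑ V₀ ∈ 𝒱, μ.real (Set.univ ∩ Bl V₀) = 1 := by
    rw [SteinerBlob.sum_measureReal_inter_blob w A o hoA Set.univ]; exact probReal_univ
  -- termwise bound
  have hterm : ∀ V₀ ∈ 𝒱, μ.real (EA ∩ Bl V₀) - μ.real (Eb ∩ Bl V₀) ≤ θ * μ.real (Set.univ ∩ Bl V₀) := by
    intro V₀ hV₀
    obtain ⟨ho, hVA⟩ := (Finset.mem_filter.1 hV₀).2
    rw [Set.univ_inter]
    by_cases hVR : V₀ ⊆ R
    · -- the contraction of the blob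
      set Ψ : BondConfig (Fin n) → BondConfig (Fin n) := fun ω =>
        ({e : Sym2 (Fin n) | (e ∈ ω ∧ ∀ v ∈ e, v ∉ V₀) ∨
          ∃ a ∈ A, e = s(o, a) ∧ ∃ u ∈ V₀, s(u, a) ∈ ω} : BondConfig (Fin n)) with hΨ
      set wt : Sym2 (Fin n) → unitInterval := fun e => (⟨μ.real {ω : BondConfig (Fin n) | e ∈ Ψ ω},
        ⟨measureReal_nonneg, measureReal_le_one⟩⟩ : unitInterval) with hwt
      -- on the blob event, reachability from `o` to a relay is read through `Ψ`
      have hreach : ∀ ω ∈ Bl V₀, ∀ a ∈ A, ((openGraph ω).Reachable o a ↔ (openGraph (Ψ ω)).Reachable o a) := by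
        intro ω hω a ha
        have haV : a ∉ V₀ := fun h => Finset.disjoint_left.1 hVA h ha
        exact SteinerBlob.reachable_contract_iff ho hVA hω (Or.inl rfl) (Or.inr haV)
      have hEA' : EA ∩ Bl V₀ = Bl V₀ ∩ Ψ ⁻¹' EA := by
        ext ω
        simp only [hEA, Set.mem_inter_iff, Set.mem_preimage, Set.mem_iUnion, exists_prop]
        constructor
        · rintro ⟨⟨a, ha, h⟩, hω⟩
          exact ⟨hω, a, ha, (hreach ω hω a ha).1 h⟩
        · rintro ⟨hω, a, ha, h⟩
          exact ⟨⟨a, ha, (hreach ω hω a ha).2 h⟩, hω⟩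
      have hEb' : Eb ∩ Bl V₀ = Bl V₀ ∩ Ψ ⁻¹' Eb := by
        ext ω
        simp only [hEb, Set.mem_inter_iff, Set.mem_preimage]
        constructor
        · rintro ⟨h, hω⟩
          exact ⟨hω, (hreach ω hω b hbA).1 h⟩
        · rintro ⟨hω, h⟩
          exact ⟨(hreach ω hω b hbA).2 h, hω⟩
      have hfacA : μ.real (EA ∩ Bl V₀) = μ.real (Bl V₀) * (prodBernoulli wt).real EA := by
        rw [hEA', SteinerBlob.measureReal_blob_inter_preimage_contract w hVA EA,
          SteinerBlob.measureReal_preimage_contract w hVA EA]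
      have hfacb : μ.real (Eb ∩ Bl V₀) = μ.real (Bl V₀) * (prodBernoulli wt).real Eb := by
        rw [hEb', SteinerBlob.measureReal_blob_inter_preimage_contract w hVA Eb,
          SteinerBlob.measureReal_preimage_contract w hVA Eb]
      -- the one-layer observer of the blob weights: KN Thm 4 in block form
      have hOA : Disjoint ({o} : Finset (Fin n)) A := Finset.disjoint_singleton_left.2 hoA
      have hiso : ∀ x ∈ ({o} : Finset (Fin n)), ∀ y : Fin n, y ∉ ({o} : Finset (Fin n)) → y ∉ A →
          wt s(x, y) = 0 := by
        intro x hx y hyo hyA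
        rw [Finset.mem_singleton] at hx hyo
        subst hx
        exact SteinerBlob.blobWeight_eq_zero w ho hyo hyA
      have hrel' : ∀ a ∈ A, (prodBernoulli (fun e : Sym2 (Fin n) =>
          if (∀ x ∈ e, x ∈ ({o} : Finset (Fin n))) ∧ ¬ e.IsDiag then 1 else wt e)).real (openConn a b)ᶜ ≤ θ := by
        intro a ha
        rw [agPartial_glue_singleton]
        exact le_trans (InternalEdge.blobWeight_compl_le_killE w ho hVR hRA hcl ha hbA) (hrel a ha)
      have hbase := pocketGlue_base wt {o} A b θ hbA hOA hiso hrel'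
      rw [agPartial_glue_singleton, Finset.set_biUnion_singleton, Finset.set_biUnion_singleton] at hbase
      -- assemble
      rw [hfacA, hfacb]
      have hBl0 : 0 ≤ μ.real (Bl V₀) := measureReal_nonneg
      nlinarith [hbase, hBl0]
    · -- blobs leaving `R` are null
      have h0 : μ.real (Bl V₀) = 0 := InternalEdge.blob_null w hoR hVA hcl hVR
      have h1 : μ.real (EA ∩ Bl V₀) ≤ μ.real (Bl V₀) :=
        measureReal_mono Set.inter_subset_right (measure_ne_top μ _)
      have h2 : 0 ≤ μ.real (Eb ∩ Bl V₀) := measureReal_nonneg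
      rw [h0] at h1 ⊢
      linarith
  -- sum up
  rw [← hsumA, ← hsumb, ← Finset.sum_sub_distrib]
  calc ∑ V₀ ∈ 𝒱, (μ.real (EA ∩ Bl V₀) - μ.real (Eb ∩ Bl V₀))
      ≤ ∑ V₀ ∈ 𝒱, θ * μ.real (Set.univ ∩ Bl V₀) := Finset.sum_le_sum hterm
    _ = θ * ∑ V₀ ∈ 𝒱, μ.real (Set.univ ∩ Bl V₀) := by rw [Finset.mul_sum]
    _ = θ := by rw [hsum1, mul_one]

end

end Summit.CriticalPhenomena.PercolationContinuityZ3.Theorems
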